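import Summits.BirchSwinnertonDyer.BirchSwinnertonDyer.Theorems.ByReductionTypeAtTwoRankOneAtTwoOffBigImageOddLocalEngineParity
import HarnessLib

/-!
# Route `ByReductionTypeAtTwo`, crux `RankOneAtTwoOffBigImageOddLocal` (stmt-BirchSwinnertonDyer-23716), line
# `refined_kolyvagin_tamagawa_shift_at_two` — ENGINE PORT `c₀ ↦ h₀` (regular element), §C Goursat, §D coset absorption, §G regular-lift dichotomy

Lead prover `prover-cruxlead-stmt-BirchSwinnertonDyer-23716-g0` (2026-08-28), landing the crux-plan g6 ENGINE QUARRY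
`Cruxes/RankOneAtTwoOffBigImageOddLocal/RefinedKolyvaginEngineG6.lean` (planner `cruxplan-…-23716-refined-kolyvag-9ff2fe475f-g6`, v4, 1631 lines,
rc 0 / 0 sorry; `Cruxes/` files are not importable, so the lead COPIES the proofs into `Theorems/` — card «LEAD QUICKSTART (g6)» Q2 #3 / Q4) as
`--supports stmt-BirchSwinnertonDyer-23716` helpers.  The engine port is kernel-closable item #3 of the pen's order (PEN-PICK-23716 ADD-4): replace
complex conjugation `c₀` by a REGULAR element `h₀` (det `−1`, trace `0`, odd mod `2`) in the tree's equivariant-Čebotarev engine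
`GenusExact.exists_kolyvaginPrime_gt_two_of_galoisElement`, so that Kolyvagin primes with LOSSLESS local Kummer maps exist on the `Δ > 0` cells of the
S₃-locus (where `ρ̄₂(c₀) = 1` loses the top bit — residual 24883), feeding the line's filtered stubs `…WithOn Φ_reg Ω` (card #7
`regular-frobenius-kolyvagin-primes-pos-disc`).  THIS FILE: §C — `graph_dichotomy_of_fst_surjective` (a subgroup `H ≤ G × C` surjecting onto `G` contains `(1, c)` with `c ≠ 1` or is the graph of a homomorphism); §D — `exists_add_mem_smul_ne_zero`, `exists_smul_add_map_ne_zero` (every coset of a subgroup containing a point of exact order `2^M` contains one: Step B's constant is harmless); §G — `regular_lift_dichotomy` / `exists_regular_lift` (for `φ : G ↠ GL₂(ℤ/2^{M+1})`, `χ : G → A = {1, τ}`: either the regular involution `regR = [[1,1],[0,−1]]` lifts with `χ = τ`, or `χ = sgn(red₂ φ)·ε(det φ)`), `charGL_eq_general`, `eps_det_eq_of_not_odd`; defs `OddModTwoGL`, `diagHom`, `regR` (reviewed).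

Statements and proofs are the quarry's VERBATIM (namespace moved to `…Theorems.OffBigImageOddLocalAtTwo.Engine`).  Nothing here proves the crux,
`BSDp W 2`, BSD or the summit; no registered stub is discharged (engine inputs only).  BSD is not proved.

Refs: [GrossLMS1991] §3 (3.1)–(3.3), §9; [McCallumLMS1991] §3; [SilvermanAEC2009] III.§1, III.§8 (Weil pairing), VII–VIII; Dokchitser–Dokchitser (2012);
Serre (1972) §5.3.
-/

set_option linter.dupNamespace false -- tree convention: `Summit.BirchSwinnertonDyer.BirchSwinnertonDyer.Theorems` (summit = sub-problem)
set_option autoImplicit false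

noncomputable section

namespace Summit.BirchSwinnertonDyer.BirchSwinnertonDyer.Theorems.OffBigImageOddLocalAtTwo.Engine

/-! ## §C  Goursat dichotomy for a subgroup of `G × C` surjecting onto `G` -/

section GoursatC

/-- **E1b (Goursat, index-`2` shape).** A subgroup `H ≤ G × C` projecting ONTO `G` and meeting `1 × C` trivially
is the graph of a homomorphism `ψ : G → C`. -/
theorem exists_hom_graph_of_fst_surjective {G C : Type*} [Group G] [Group C] (H : Subgroup (G × C))
    (hfst : ∀ g : G, ∃ c : C, (g, c) ∈ H) (hker : ∀ c : C, ((1 : G), c) ∈ H → c = 1) :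
    ∃ ψ : G →* C, ∀ g : G, ∀ c : C, (g, c) ∈ H ↔ c = ψ g := by
  classical
  have huniq : ∀ g : G, ∀ c c' : C, (g, c) ∈ H → (g, c') ∈ H → c = c' := by
    intro g c c' hc hc'
    have hmem : ((1 : G), c⁻¹ * c') ∈ H := by
      have := H.mul_mem (H.inv_mem hc) hc'
      simpa using this
    have := hker _ hmem
    rw [inv_mul_eq_one] at this
    exact this
  let f : G → C := fun g ↦ Classical.choose (hfst g)
  have hf : ∀ g, (g, f g) ∈ H := fun g ↦ Classical.choose_spec (hfst g)
  refine ⟨{ toFun := f, map_one' := ?_, map_mul' := ?_ }, ?_⟩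
  · exact (hker _ (hf 1))
  · intro g g'
    have hmem : (g * g', f g * f g') ∈ H := by
      have := H.mul_mem (hf g) (hf g')
      simpa using this
    exact huniq _ _ _ (hf (g * g')) hmem
  · intro g c
    constructor
    · intro hc; exact huniq _ _ _ hc (hf g)
    · rintro rfl; exact hf g

/-- **E1b′ (the dichotomy used by the regular supply).** If `H ≤ G × C` projects onto `G`, then EITHER some
`(1, c)` with `c ≠ 1` lies in `H` (and then `(g, c·x) ∈ H` whenever `(g, x) ∈ H`: every `G`-component meets every
`C`-coset it can), OR `H` is the graph of a homomorphism `ψ : G → C`. -/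
theorem graph_dichotomy_of_fst_surjective {G C : Type*} [Group G] [Group C] (H : Subgroup (G × C))
    (hfst : ∀ g : G, ∃ c : C, (g, c) ∈ H) :
    (∃ c : C, c ≠ 1 ∧ ((1 : G), c) ∈ H) ∨ (∃ ψ : G →* C, ∀ g : G, ∀ c : C, (g, c) ∈ H ↔ c = ψ g) := by
  by_cases h : ∃ c : C, c ≠ 1 ∧ ((1 : G), c) ∈ H
  · exact Or.inl h
  · push Not at h
    exact Or.inr (exists_hom_graph_of_fst_surjective H hfst fun c hc ↦ by
      by_contra hne; exact h c hne hc)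

/-- In the first branch: `(1, c) ∈ H` and `(g, x) ∈ H` give `(g, c * x) ∈ H`. -/
theorem mem_of_one_mem {G C : Type*} [Group G] [Group C] (H : Subgroup (G × C)) {g : G} {c x : C}
    (h1 : ((1 : G), c) ∈ H) (hg : (g, x) ∈ H) : (g, c * x) ∈ H := by
  have := H.mul_mem h1 hg
  simpa using this

end GoursatC

/-! ## §D  Coset absorption (card E2: Step B with a non-involution `h₀` — the constant `c(h₀²)` cannot destroy exact order) -/

section CosetD

/-- If a subgroup `H` contains an element `h` with `k • h ≠ 0`, then EVERY coset `v + H` contains an element `v + w` with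
`k • (v + w) ≠ 0` (take `w = h` if `k • v = 0`, else `w = 0`).  Used with `V = E[2^M]`, `k = 2^{M-1}`: the evaluation
`c(σ²) = (const) + (element ranging over a subgroup containing a point of exact order 2^M)` still hits exact order `2^M`. -/
theorem exists_add_mem_smul_ne_zero {V : Type*} [AddCommGroup V] {k : ℕ} (H : AddSubgroup V)
    {h : V} (hh : h ∈ H) (hord : k • h ≠ 0) (v : V) : ∃ w ∈ H, k • (v + w) ≠ 0 := by
  by_cases hv : k • v = 0
  · exact ⟨h, hh, by rwa [smul_add, hv, zero_add]⟩
  · exact ⟨0, H.zero_mem, by rwa [add_zero]⟩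

/-- The same for the image of an additive map `f : U →+ V` in place of a subgroup (the shape in which Step B produces it:
`m' ↦ c(m')`-type terms range over an additive image). -/
theorem exists_smul_add_map_ne_zero {U V : Type*} [AddCommGroup U] [AddCommGroup V] {k : ℕ} (f : U →+ V)
    {u : U} (hord : k • f u ≠ 0) (v : V) : ∃ u' : U, k • (v + f u') ≠ 0 := by
  by_cases hv : k • v = 0
  · exact ⟨u, by rwa [smul_add, hv, zero_add]⟩
  · exact ⟨0, by rwa [map_zero, add_zero]⟩

end CosetD

/-! ## §G  Regular-lift dichotomy (card E1c at GROUP level, PROVED): from `φ : G ↠ GL₂(ℤ/2^{M+1})`, `χ : G → A ≅ C₂` -/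

section RegularLiftG

open Matrix
open scoped MatrixGroups Classical

variable {M : ℕ} {A : Type*} [CommGroup A]

/-- Parity of `g mod 2` for `g ∈ GL₂(ℤ/2^{M+1})`: `g mod 2` is a transposition of `GL₂(𝔽₂) ≅ S₃`. -/
def OddModTwoGL (g : GL (Fin 2) (ZMod (2 ^ (M + 1)))) : Prop :=
  redTwo M (g.val 0 0 + g.val 1 1) = 0 ∧ (redTwo M (g.val 0 1) ≠ 0 ∨ redTwo M (g.val 1 0) ≠ 0)

/-- `OddModTwoGL` on the image of `SL₂` is `OddModTwo`. [folklore] -/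
theorem oddModTwoGL_toGL_iff (s : SL(2, ZMod (2 ^ (M + 1)))) :
    OddModTwoGL (Matrix.SpecialLinearGroup.toGL s) ↔ OddModTwo s := Iff.rfl

/-- `x ↦ diag(x, 1)`, a homomorphism `(ℤ/2^{M+1})ˣ → GL₂(ℤ/2^{M+1})` splitting `det`. -/
def diagHom (M : ℕ) : (ZMod (2 ^ (M + 1)))ˣ →* GL (Fin 2) (ZMod (2 ^ (M + 1))) where
  toFun x := diagGL (x : ZMod (2 ^ (M + 1))) ((x⁻¹ : (ZMod (2 ^ (M + 1)))ˣ) : ZMod (2 ^ (M + 1))) x.mul_inv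
  map_one' := by
    apply Units.ext
    change (!![((1 : (ZMod (2 ^ (M + 1)))ˣ) : ZMod (2 ^ (M + 1))), 0; 0, 1] : Matrix (Fin 2) (Fin 2) (ZMod (2 ^ (M + 1)))) = 1
    rw [Matrix.one_fin_two, Units.val_one]
  map_mul' x y := by
    apply Units.ext
    change (!![((x * y : (ZMod (2 ^ (M + 1)))ˣ) : ZMod (2 ^ (M + 1))), 0; 0, 1] : Matrix (Fin 2) (Fin 2) (ZMod (2 ^ (M + 1)))) =
      !![(x : ZMod (2 ^ (M + 1))), 0; 0, 1] * !![(y : ZMod (2 ^ (M + 1))), 0; 0, 1]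
    rw [Matrix.mul_fin_two, Units.val_mul]
    (congr 1; simp)

/-- The matrix of `diagHom M x` is `diag(x, 1)`. [folklore] -/
theorem val_diagHom (x : (ZMod (2 ^ (M + 1)))ˣ) :
    ((diagHom M x : GL (Fin 2) (ZMod (2 ^ (M + 1)))) : Matrix (Fin 2) (Fin 2) (ZMod (2 ^ (M + 1)))) =
      !![(x : ZMod (2 ^ (M + 1))), 0; 0, 1] := rfl

/-- The matrix of `(diagHom M x)⁻¹` is `diag(x⁻¹, 1)`. [folklore] -/
theorem val_diagHom_inv (x : (ZMod (2 ^ (M + 1)))ˣ) :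
    (((diagHom M x)⁻¹ : GL (Fin 2) (ZMod (2 ^ (M + 1)))) : Matrix (Fin 2) (Fin 2) (ZMod (2 ^ (M + 1)))) =
      !![((x⁻¹ : (ZMod (2 ^ (M + 1)))ˣ) : ZMod (2 ^ (M + 1))), 0; 0, 1] := rfl

/-- `det (diagHom M x) = x`. [folklore] -/
theorem det_diagHom (x : (ZMod (2 ^ (M + 1)))ˣ) : Matrix.GeneralLinearGroup.det (diagHom M x) = x := by
  apply Units.ext
  rw [Matrix.GeneralLinearGroup.val_det_apply, val_diagHom, Matrix.det_fin_two_of]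
  ring

/-- parity is insensitive to right multiplication by `diag(e, 1)`, `e` a unit -/
theorem oddModTwo_iff_of_coe_eq (s : SL(2, ZMod (2 ^ (M + 1)))) (g : GL (Fin 2) (ZMod (2 ^ (M + 1))))
    (e : ZMod (2 ^ (M + 1))) (he : redTwo M e = 1)
    (hs : (s : Matrix (Fin 2) (Fin 2) (ZMod (2 ^ (M + 1)))) = g.val * !![e, 0; 0, 1]) :
    OddModTwo s ↔ OddModTwoGL g := by
  have h00 : s 0 0 = g.val 0 0 * e := by
    have := congrFun (congrFun hs 0) 0; simpa [Matrix.mul_apply, Fin.sum_univ_two] using this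
  have h01 : s 0 1 = g.val 0 1 := by
    have := congrFun (congrFun hs 0) 1; simpa [Matrix.mul_apply, Fin.sum_univ_two] using this
  have h10 : s 1 0 = g.val 1 0 * e := by
    have := congrFun (congrFun hs 1) 0; simpa [Matrix.mul_apply, Fin.sum_univ_two] using this
  have h11 : s 1 1 = g.val 1 1 := by
    have := congrFun (congrFun hs 1) 1; simpa [Matrix.mul_apply, Fin.sum_univ_two] using this
  unfold OddModTwo OddModTwoGL
  rw [h00, h01, h10, h11, map_add, map_mul, he, mul_one, map_mul, he, mul_one, ← map_add]

/-- **E1a, GL form, general `g`.**  `ψ(g) = sgn-part(g) · ε(det g)` with `ε := ψ ∘ diag(·, 1)`: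
every `ψ : GL₂(ℤ/2^{M+1}) → A` (abelian, `ψ(u)² = 1`) is `(sgn ∘ red₂)^{a} · (ε ∘ det)`, `a ∈ {0, 1}`. -/
theorem charGL_eq_general (ψ : GL (Fin 2) (ZMod (2 ^ (M + 1))) →* A)
    (h2 : ψ (Matrix.SpecialLinearGroup.toGL (uS M)) ^ 2 = 1) (g : GL (Fin 2) (ZMod (2 ^ (M + 1)))) :
    ψ g = (if OddModTwoGL g then ψ (Matrix.SpecialLinearGroup.toGL (uS M)) else 1) *
      ψ (diagHom M (Matrix.GeneralLinearGroup.det g)) := by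
  set d := Matrix.GeneralLinearGroup.det g with hd
  have hdet : Matrix.GeneralLinearGroup.det g = Matrix.GeneralLinearGroup.det (diagHom M d) := by
    rw [det_diagHom]
  have hd1 : ((g * (diagHom M d)⁻¹ : GL (Fin 2) (ZMod (2 ^ (M + 1)))) :
      Matrix (Fin 2) (Fin 2) (ZMod (2 ^ (M + 1)))).det = 1 := by
    have h1 : Matrix.GeneralLinearGroup.det (g * (diagHom M d)⁻¹) = 1 := by
      rw [map_mul, map_inv, ← hdet, mul_inv_cancel]
    have h2' := congrArg (fun u : (ZMod (2 ^ (M + 1)))ˣ ↦ (u : ZMod (2 ^ (M + 1)))) h1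
    simpa [Matrix.GeneralLinearGroup.val_det_apply] using h2'
  have hπ : redTwo M (((d⁻¹ : (ZMod (2 ^ (M + 1)))ˣ) : ZMod (2 ^ (M + 1)))) = 1 :=
    (isUnit_iff_redTwo_eq_one _).mp (Units.isUnit _)
  have hpar := oddModTwo_iff_of_coe_eq
    (⟨((g * (diagHom M d)⁻¹ : GL (Fin 2) (ZMod (2 ^ (M + 1)))) : Matrix (Fin 2) (Fin 2) (ZMod (2 ^ (M + 1)))), hd1⟩ :
      SL(2, ZMod (2 ^ (M + 1)))) g _ hπ (by
        change ((g * (diagHom M d)⁻¹ : GL (Fin 2) (ZMod (2 ^ (M + 1)))) : Matrix (Fin 2) (Fin 2) (ZMod (2 ^ (M + 1)))) = _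
        rw [Units.val_mul, val_diagHom_inv])
  rw [charGL_mul_inv_eq ψ h2 g (diagHom M d) hdet hd1]
  by_cases hodd : OddModTwoGL g
  · rw [if_pos hodd, if_pos (hpar.mpr hodd)]
  · rw [if_neg hodd, if_neg (fun h ↦ hodd (hpar.mp h))]

/-- In a group in which every element is `1` or `τ`, every square is `1`. -/
theorem sq_eq_one_of_two_valued {τ : A} (hA : ∀ a : A, a = 1 ∨ a = τ) (a : A) : a ^ 2 = 1 := by
  have hτ : τ ^ 2 = 1 := by
    rcases hA (τ ^ 2) with h | h
    · exact h
    · have h1 : τ = 1 := by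
        have := congrArg (· * τ⁻¹) h
        simpa [pow_two] using this
      rw [h1, one_pow]
  rcases hA a with rfl | rfl
  · exact one_pow 2
  · exact hτ

/-- **E1c at group level (the regular-lift dichotomy), PROVED.**  Let `φ : G → GL₂(ℤ/2^{M+1})` be SURJECTIVE and
`χ : G → A` a homomorphism to a group all of whose elements are `1` or `τ` (think `G = Gal(ℚ(E[2^{M+1}])K/ℚ)`,
`φ = ρ_{E,2^{M+1}}`, `A = Gal(K/ℚ) = {1, τ}`, `χ = res_K`), and `g₀ ∈ G` with `χ g₀ = τ` (complex conjugation).  Then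
EITHER every `R ∈ GL₂(ℤ/2^{M+1})` with `det R = det φ(g₀)` lifts to some `g` with `φ g = R` AND `χ g = τ` — in
particular the regular involution `regR = [[1,1],[0,-1]]` does when `det φ(g₀) = -1`, giving the element `h₀` of E1 —
OR `τ ≠ 1` and `χ = (sgn ∘ red₂ ∘ φ) · (ε ∘ det ∘ φ)` for a character `ε` of `(ℤ/2^{M+1})ˣ` (with values in `{1, τ}`):
the exceptional branch, which the lead closes ARITHMETICALLY (`sgn ∘ red₂ ∘ ρ̄` is the quadratic character of `ℚ(√Δ)` by
`isSquare_Δ_iff_forall_smul_delta` / §A; `ε ∘ det ρ = ε ∘ χ_cyc` is one of `1, χ₋₄, χ₈, χ₋₈`; so `K ⊂ ℚ(√±Δ, √±2Δ)`,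
i.e. `K ∈ {ℚ(√-Δ), ℚ(√-2Δ)}` for `Δ > 0` — exactly the crux-side exclusions, negatives `stmt-…-24881`).
Ingredients: §C `graph_dichotomy_of_fst_surjective`, §B `charGL_eq_of_det_eq`, `charGL_eq_general`. -/
theorem regular_lift_dichotomy {G : Type*} [Group G]
    (φ : G →* GL (Fin 2) (ZMod (2 ^ (M + 1)))) (hφ : Function.Surjective φ) (χ : G →* A)
    {τ : A} (hA : ∀ a : A, a = 1 ∨ a = τ) {g₀ : G} (hg₀ : χ g₀ = τ) :
    (∀ R : GL (Fin 2) (ZMod (2 ^ (M + 1))),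
        Matrix.GeneralLinearGroup.det R = Matrix.GeneralLinearGroup.det (φ g₀) → ∃ g : G, φ g = R ∧ χ g = τ) ∨
    (τ ≠ 1 ∧ ∃ ε : (ZMod (2 ^ (M + 1)))ˣ →* A, ∀ g : G,
        χ g = (if OddModTwoGL (φ g) then τ else 1) * ε (Matrix.GeneralLinearGroup.det (φ g))) := by
  set H : Subgroup (GL (Fin 2) (ZMod (2 ^ (M + 1))) × A) := (φ.prod χ).range with hH
  have hmem : ∀ g : G, (φ g, χ g) ∈ H := fun g ↦ MonoidHom.mem_range.mpr ⟨g, rfl⟩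
  have hfst : ∀ R : GL (Fin 2) (ZMod (2 ^ (M + 1))), ∃ c : A, (R, c) ∈ H := fun R ↦ by
    obtain ⟨g, rfl⟩ := hφ R
    exact ⟨χ g, hmem g⟩
  rcases graph_dichotomy_of_fst_surjective H hfst with ⟨c, hc1, hcH⟩ | ⟨ψ, hψ⟩
  · -- branch 1: `(1, τ) ∈ H` — every matrix lifts with either value of `χ`
    left
    intro R _
    obtain ⟨g₁, rfl⟩ := hφ R
    rcases hA (χ g₁) with h1 | h1
    · obtain ⟨g₂, hg₂⟩ := MonoidHom.mem_range.mp hcH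
      have hφ₂ : φ g₂ = 1 := (Prod.ext_iff.mp hg₂).1
      have hχ₂ : χ g₂ = c := (Prod.ext_iff.mp hg₂).2
      refine ⟨g₂ * g₁, by rw [map_mul, hφ₂, one_mul], ?_⟩
      rw [map_mul, hχ₂, h1, mul_one]
      exact (hA c).resolve_left hc1
    · exact ⟨g₁, rfl, h1⟩
  · -- branch 2: `H` is the graph of `ψ`, `χ = ψ ∘ φ`
    have hχ : ∀ g : G, χ g = ψ (φ g) := fun g ↦ (hψ (φ g) (χ g)).mp (hmem g)
    have h2 : ψ (Matrix.SpecialLinearGroup.toGL (uS M)) ^ 2 = 1 := sq_eq_one_of_two_valued hA _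
    by_cases hu : ψ (Matrix.SpecialLinearGroup.toGL (uS M)) = 1
    · left
      intro R hR
      obtain ⟨g₁, rfl⟩ := hφ R
      exact ⟨g₁, rfl, by rw [hχ, charGL_eq_of_det_eq ψ hu _ _ hR, ← hχ, hg₀]⟩
    · right
      have hψu : ψ (Matrix.SpecialLinearGroup.toGL (uS M)) = τ := (hA _).resolve_left hu
      refine ⟨fun h1 ↦ hu (hψu.trans h1), ψ.comp (diagHom M), fun g ↦ ?_⟩
      rw [hχ, charGL_eq_general ψ h2 (φ g), hψu, MonoidHom.comp_apply]

/-- The REGULAR involution `R = [[1,1],[0,-1]] ∈ GL₂(ℤ/2^{M+1})`: `det R = -1`, `R² = 1`, `R mod 2 = u` is a transposition;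
`(1 + R) E ∋ (1,0)ᵀ·(…)` and `(R - 1) E` both contain vectors of exact order `2^{M+1}` (R1/LKL: LOSSLESS). -/
def regR (M : ℕ) : GL (Fin 2) (ZMod (2 ^ (M + 1))) :=
  ⟨!![1, 1; 0, -1], !![1, 1; 0, -1],
    by rw [Matrix.mul_fin_two, Matrix.one_fin_two]; (congr 1; simp),
    by rw [Matrix.mul_fin_two, Matrix.one_fin_two]; (congr 1; simp)⟩

/-- The matrix of the regular involution `regR M` is `[[1,1],[0,-1]]`. [folklore] -/
theorem val_regR : ((regR M : GL (Fin 2) (ZMod (2 ^ (M + 1)))) : Matrix (Fin 2) (Fin 2) (ZMod (2 ^ (M + 1)))) =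
    !![1, 1; 0, -1] := rfl

/-- `regR` is an involution of `GL₂(ℤ/2^{M+1})`. [folklore] -/
theorem regR_mul_regR : regR M * regR M = 1 :=
  Units.ext (by rw [Units.val_mul, val_regR, Matrix.mul_fin_two, Units.val_one, Matrix.one_fin_two]; (congr 1; simp))

/-- `det regR = -1`. [folklore] -/
theorem det_regR : Matrix.GeneralLinearGroup.det (regR M) = -1 := by
  apply Units.ext
  rw [Matrix.GeneralLinearGroup.val_det_apply, val_regR, Matrix.det_fin_two_of, Units.val_neg, Units.val_one]
  ring

/-- `regR` is ODD mod `2` (its reduction is a transposition of `SL₂(𝔽₂) ≅ S₃`). [folklore] -/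
theorem oddModTwoGL_regR : OddModTwoGL (regR M) := by
  unfold OddModTwoGL
  refine ⟨?_, Or.inl ?_⟩
  · change redTwo M ((1 : ZMod (2 ^ (M + 1))) + -1) = 0
    rw [add_neg_cancel, map_zero]
  · change redTwo M (1 : ZMod (2 ^ (M + 1))) ≠ 0
    rw [map_one]; exact one_ne_zero

/-- **E1c, usable form.**  In branch 1 of `regular_lift_dichotomy` with `det φ(g₀) = -1`: a lift `h` of the regular
involution with `χ h = τ` exists. -/
theorem exists_regular_lift {G : Type*} [Group G]
    (φ : G →* GL (Fin 2) (ZMod (2 ^ (M + 1)))) (χ : G →* A) {τ : A} {g₀ : G}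
    (hdet : Matrix.GeneralLinearGroup.det (φ g₀) = -1)
    (h : ∀ R : GL (Fin 2) (ZMod (2 ^ (M + 1))),
        Matrix.GeneralLinearGroup.det R = Matrix.GeneralLinearGroup.det (φ g₀) → ∃ g : G, φ g = R ∧ χ g = τ) :
    ∃ g : G, φ g = regR M ∧ χ g = τ :=
  h (regR M) (by rw [det_regR, hdet])

/-- In branch 2, evaluating at `g₀` itself: if `φ g₀ mod 2` is NOT a transposition (e.g. `Δ > 0`: `ρ̄₂(c₀) = 1`) then
`ε(det φ g₀) = τ ≠ 1` — the character `ε` is ODD (`ε(-1) = τ`), which is what pins `K` to `ℚ(√-Δ)`/`ℚ(√-2Δ)`. -/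
theorem eps_det_eq_of_not_odd {G : Type*} [Group G]
    (φ : G →* GL (Fin 2) (ZMod (2 ^ (M + 1)))) (χ : G →* A) {τ : A} {g₀ : G} (hg₀ : χ g₀ = τ)
    (ε : (ZMod (2 ^ (M + 1)))ˣ →* A)
    (hε : ∀ g : G, χ g = (if OddModTwoGL (φ g) then τ else 1) * ε (Matrix.GeneralLinearGroup.det (φ g)))
    (heven : ¬ OddModTwoGL (φ g₀)) : ε (Matrix.GeneralLinearGroup.det (φ g₀)) = τ := by
  have := hε g₀
  rw [hg₀, if_neg heven, one_mul] at this
  exact this.symm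

end RegularLiftG

end Summit.BirchSwinnertonDyer.BirchSwinnertonDyer.Theorems.OffBigImageOddLocalAtTwo.Engine

end
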